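import Summits.BirchSwinnertonDyer.BirchSwinnertonDyer.Theorems.GoldfeldAllTwistsTwoConverseTwinEvenTwistTwoAdic
import Summits.BirchSwinnertonDyer.BirchSwinnertonDyer.Theorems.GoldfeldAllTwistsTwoConverseTwinInertSevenPartnerLValue
import Summits.BirchSwinnertonDyer.BirchSwinnertonDyer.Theorems.GoldfeldAllTwistsTwoConverseTwinGenusDescentRankZero
import HarnessLib

set_option linter.dupNamespace false -- namespace `…BirchSwinnertonDyer.BirchSwinnertonDyer…` is the cell's (D-0017 nested layout)
set_option autoImplicit false

/-!
# LINE C3 (EVEN-TWIST LAW), file 1b: the `2`-isogeny descent of the EVEN partner `49a1^{(2p)}`,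
# `p ≡ 5 (mod 8)` prime SPLIT in `ℚ(√−7)` — `#S ≤ 2`, `#S' ≤ 2`, rank `0`, `Ш[2] = 0`, `corank₂ Sel_{2^∞} = 0`

Cell `bsd-goldfeld`, seat `bsd-goldfeld-s1p-c3x` (gen 7); planner ORDER «LINE C3» (ruling (ccxxi)); second half of C3-1
(first half: `…TwinEvenTwistTwoAdic`, the `2`-adic kills). `--supports stmt-BirchSwinnertonDyer-19350` as a HELPER.
Theses-free; theorems only (no definition, no fact binder, no `sorry`). FACT-FREE (UNCONDITIONAL).

OBJECT. For a prime `p ≡ 5 (mod 8)` with `(−7/p) = +1` (split in `ℚ(√−7)`; `p = 29, 37, 53, 61, 101, …`) the two-torsion model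
`E_{2p} : y² = x³ + 42p·x² + 448p²·x` (`= C₀ • 49a1^{(2p)}` by seat c301's `smul_eq_twoTorsionModel_of_smul_eq_quadraticTwist`,
`d = 2p`) has `2`-isogeny Selmer sets `S(42p, 448p²) ⊆ {1, 7, 14p}` and `S' = S(−84p, −28p²) ⊆ {1, −7, −14p}`; the orders being
powers of `2`, **`#S ≤ 2` and `#S' ≤ 2`** (`card_twoIsogenySelmerGroup_twoPosTwist_le`, `card_twoIsogenySelmerGroup'_twoPosTwist_le`),
hence `rank E_{2p}(ℚ) = 0`, `Ш[2] = 0` (c301's `rank_eq_zero_and_sha_two_of_card_le_two`) for EVERY model `W` of `49a1^{(2p)}`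
(`rank_eq_zero_and_sha_two_twoPosTwist`) and `corank_{ℤ₂} Sel_{2^∞}(W) = 0` (`selmerCorank_two_eq_zero_twoPosTwist`, Greenberg's
identity `selmerCorank_eq_mordellWeilRank_add_holds`) — the hypothesis of Burungale–Tian's rank-zero `2`-converse, discharged
unconditionally; file C3-2 `…TwinEvenTwistLValue` turns it into `ord₂(L(49a1^{(2p)},1)/Ω_∞) = 3`. This is the EVEN companion of
c301's `rank_eq_zero_and_sha_two_posTwist_of_symbol_neg` (`49a1^{(p)}`, `σ(p) = −1`); for `2p` at `p ≡ 5 (mod 8)` NO symbol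
condition enters (the quartic symbol `(−7/p)₄` matters only at `p ≡ 1 (mod 8)`, not treated).

LOCAL KILLS. `S`: `d < 0` at `∞` (`a² = 1764p² < 4·448p²`, c301's `not_isSoluble_real_twoIsogenyQuartic_of_neg_of_sq_lt`);
`d = 2, 14` at `p` (`2, 224` resp. `14, 32` non-residues: `(2/p) = −1`, `(7/p) = +1`; c301's `not_isSoluble_padic_of_nonresidue_of_sq_dvd`);
`d = p, 2p, 7p` at `2` (file 1a). `S'`: `d = −1, −2, −p, −2p, 7, 14, 7p, 14p` at `7` (`7 ∥ a'² − 4dd' = 7168p²`, `p` a square mod `7`;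
Zywina's `isSquare_zmod_of_isSoluble_padic` — verbatim the argument of c301's `…TwinAdditiveTwoSplitFiveTwistSelmer` for `49a1^{(−2ℓ)}`,
whose `S'` has the same `b' = −28ℓ²`); `d = 2, −14` at `p`; `d = p, 2p, −7p` at `2` (file 1a).

NUMERICS (kit j294319, PARI 2.17.3; evidence on item 19350): all `182` primes `p ≡ 5 (mod 8)`, `(p/7) = +1`, `p < 12000` (`92` with
`(−7/p)₄ ≠ 1`, `90` with `(−7/p)₄ = 1`): `49a1^{(2p)}` has analytic rank `0` and ODD analytic `#Ш` (`182/182`); FALSIFIER = any such `p`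
with `Ш_an(49a1^{(2p)})` even or `L(49a1^{(2p)},1) = 0`. HONEST FRAMING: arithmetic of the rank-ZERO even partner only; no Heegner
point, no `L`-value, no case of K12₂″ / twin″ decided; BSD is not proved by any of this.

References: Silverman, *AEC* (2009), X.4.2(a), X.4.9–X.4.10, III.3.1(b) [SilvermanAEC2009]; Zywina, arXiv:2502.01957, Lemma 3.1
[Zywina2025]; Greenberg, LNM 1716 (1999) §1 [Greenberg1999].
-/

noncomputable section

open scoped Classical

open WeierstrassCurve Literature.NumberTheory.EllipticCurves
open Literature.NumberTheory.EllipticCurves.Zywina2025 (isSquare_zmod_of_isSoluble_padic)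

namespace Summit.BirchSwinnertonDyer.BirchSwinnertonDyer.Theorems.GoldfeldGoodTwists

/-! ## §1. (Residue facts at `p` and `7`: file 1a, `residues_mod_p_fiveModEight`, `p_square_mod_seven`, `zmod_seven_table'`.) -/

/-! ## §2. The Selmer orders `#S(42p, 448p²) ≤ 2`, `#S(−84p, −28p²) ≤ 2` -/

/-- `b(a² − 4b) ≠ 0` for `E_{2p}` in the `(42p, 448p²)` spelling. [folklore] -/
theorem hab_twoPosTwist {p : ℕ} (hp : 0 < p) :
    (448 * (p : ℤ) ^ 2) * ((42 * (p : ℤ)) ^ 2 - 4 * (448 * (p : ℤ) ^ 2)) ≠ 0 := by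
  have hp0 : (p : ℤ) ≠ 0 := by exact_mod_cast hp.ne'
  rw [show ((42 * (p : ℤ)) ^ 2 - 4 * (448 * (p : ℤ) ^ 2)) = -28 * p ^ 2 by ring]
  exact mul_ne_zero (mul_ne_zero (by norm_num) (pow_ne_zero 2 hp0)) (mul_ne_zero (by norm_num) (pow_ne_zero 2 hp0))

/-- **`#S(42p, 448p²) ≤ 2`** for a prime `p ≡ 5 (mod 8)` with `(−7/p) = +1`: `S ⊆ {1, 7, 14p}` (negatives die at `∞`,
`2, 14` at `p`, `p, 2p, 7p` at `2`) and `#S` is a power of `2`. [cite: SilvermanAEC2009, Prop. X.4.9 and Example X.4.10] -/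
theorem card_twoIsogenySelmerGroup_twoPosTwist_le {p : ℕ} [Fact p.Prime] (hp8 : p % 8 = 5)
    (hp7 : legendreSym p (-7) = 1) :
    (twoIsogenySelmerGroup (42 * p) (448 * p ^ 2)).card ≤ 2 := by
  have hp : p.Prime := Fact.out
  have hpp : Prime (p : ℤ) := Nat.prime_iff_prime_int.mp hp
  have hp0 : (p : ℤ) ≠ 0 := by exact_mod_cast hp.ne_zero
  have hppos : (0 : ℤ) < p := by exact_mod_cast hp.pos
  have hb : (448 * p ^ 2 : ℤ) ≠ 0 := by positivity
  obtain ⟨h2, h14, h32, h224, -⟩ := residues_mod_p_fiveModEight hp8 hp7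
  obtain ⟨k1, k2, k3, -, -, -⟩ := not_isSoluble_two_twoPosTwist hp8
  have hsub : twoIsogenySelmerGroup (42 * p) (448 * p ^ 2) ⊆ ({1, 7, (p : ℤ) * 14} : Finset ℤ) := by
    intro d hd
    rw [mem_twoIsogenySelmerGroup_iff hb] at hd
    obtain ⟨hsqf, ⟨d', hdd'⟩, hloc⟩ := hd
    have hd'eq : (448 * p ^ 2 : ℤ) / d = d' := by
      rw [hdd', Int.mul_ediv_cancel_left _ hsqf.ne_zero]
    rw [hd'eq] at hloc
    obtain ⟨hreal, hpadic⟩ := hloc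
    have hdpos : 0 < d := by
      rcases lt_or_gt_of_ne hsqf.ne_zero with hneg | hpos
      · exfalso
        refine not_isSoluble_real_twoIsogenyQuartic_of_neg_of_sq_lt hneg ?_ hreal
        rw [← hdd']; nlinarith [sq_nonneg (p : ℤ)]
      · exact hpos
    have hne2 : d ≠ 2 := by
      rintro rfl
      have hd'1 : d' = (p : ℤ) ^ 2 * 224 := by linarith
      exact not_isSoluble_padic_of_nonresidue_of_sq_dvd (p := p) (c := 42) (e' := 224) (by ring)
        hd'1 h2 h224 (hpadic p)
    have hne14 : d ≠ 14 := by
      rintro rfl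
      have hd'1 : d' = (p : ℤ) ^ 2 * 32 := by linarith
      exact not_isSoluble_padic_of_nonresidue_of_sq_dvd (p := p) (c := 42) (e' := 32) (by ring)
        hd'1 h14 h32 (hpadic p)
    have h0 : d ∣ 448 * (p : ℤ) ^ 2 := ⟨d', hdd'⟩
    have h1 : d ∣ (14 * (p : ℤ)) ^ 6 := h0.trans ⟨16807 * (p : ℤ) ^ 4, by ring⟩
    have h14p : d ∣ 14 * (p : ℤ) := (hsqf.dvd_pow_iff_dvd (by norm_num)).mp h1
    simp only [Finset.mem_insert, Finset.mem_singleton]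
    by_cases hpd : (p : ℤ) ∣ d
    · obtain ⟨e, rfl⟩ := hpd
      have he14 : e ∣ 14 := by
        have : (p : ℤ) * e ∣ (p : ℤ) * 14 := by rw [mul_comm (p : ℤ) 14]; exact h14p
        exact (mul_dvd_mul_iff_left hp0).mp this
      have hd'e : e * d' = 448 * p := mul_left_cancel₀ hp0 (by linear_combination -hdd')
      have hepos : 0 < e := pos_of_mul_pos_right hdpos hppos.le
      have hele : e ≤ 14 := Int.le_of_dvd (by norm_num) he14
      -- at `2`: `e = 1, 2, 7`
      have hne1 : e ≠ 1 := by
        rintro rfl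
        have hd'1 : d' = (p : ℤ) * 448 := by linarith
        rw [hd'1] at hpadic
        exact k1 (hpadic 2)
      have hne2' : e ≠ 2 := by
        rintro rfl
        have hd'1 : d' = (p : ℤ) * 224 := by linarith
        rw [hd'1] at hpadic
        exact k2 (hpadic 2)
      have hne7 : e ≠ 7 := by
        rintro rfl
        have hd'1 : d' = (p : ℤ) * 64 := by linarith
        rw [hd'1] at hpadic
        exact k3 (hpadic 2)
      obtain ⟨k, hk⟩ := he14
      interval_cases e <;> first | (exfalso; omega) | simp
    · have hcop : IsCoprime d (p : ℤ) := ((hpp.irreducible.coprime_iff_not_dvd).mpr hpd).symm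
      have hd14 : d ∣ 14 := hcop.dvd_of_dvd_mul_right h14p
      have hle : d ≤ 14 := Int.le_of_dvd (by norm_num) hd14
      obtain ⟨k, hk⟩ := hd14
      interval_cases d <;> first | (exfalso; omega) | simp
  obtain ⟨k, hk⟩ := exists_card_twoIsogenySelmerGroup_eq_two_pow (hab_twoPosTwist hp.pos)
  have hle3 : (twoIsogenySelmerGroup (42 * p) (448 * p ^ 2)).card ≤ 3 :=
    (Finset.card_le_card hsub).trans Finset.card_le_three
  rw [hk] at hle3 ⊢
  have hk2 : k < 2 := (Nat.pow_lt_pow_iff_right one_lt_two).mp (lt_of_le_of_lt hle3 (by norm_num))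
  calc 2 ^ k ≤ 2 ^ 1 := Nat.pow_le_pow_right two_pos (by omega)
    _ = 2 := by norm_num

/-- **`#S'(42p, 448p²) = #S(−84p, −28p²) ≤ 2`** for a prime `p ≡ 5 (mod 8)` with `(−7/p) = +1`: `S' ⊆ {1, −7, −14p}`
(`−1, −2, −p, −2p, 7, 14, 7p, 14p` die at `7`, `2, −14` at `p`, `p, 2p, −7p` at `2`) and `#S'` is a power of `2`.
[cite: SilvermanAEC2009, Prop. X.4.9] [cite: Zywina2025, Lemma 3.1 (proof)] -/
theorem card_twoIsogenySelmerGroup'_twoPosTwist_le {p : ℕ} [Fact p.Prime] (hp8 : p % 8 = 5)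
    (hp7 : legendreSym p (-7) = 1) :
    (twoIsogenySelmerGroup' (42 * p) (448 * p ^ 2)).card ≤ 2 := by
  have hp : p.Prime := Fact.out
  haveI : Fact (Nat.Prime 7) := ⟨by norm_num⟩
  have hpp : Prime (p : ℤ) := Nat.prime_iff_prime_int.mp hp
  have hp0 : (p : ℤ) ≠ 0 := by exact_mod_cast hp.ne_zero
  have hp7' : p ≠ 7 := by rintro rfl; norm_num at hp8
  obtain ⟨hp07, hpsq⟩ := p_square_mod_seven (by omega) hp7 hp7'
  have htab := zmod_seven_table' (p : ZMod 7) hpsq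
  have hp07Z : ((p : ℤ) : ZMod 7) ≠ 0 := by exact_mod_cast hp07
  obtain ⟨h2, -, -, -, hm14⟩ := residues_mod_p_fiveModEight hp8 hp7
  obtain ⟨-, -, -, k1, k2, k7⟩ := not_isSoluble_two_twoPosTwist hp8
  have hA : (-2 * (42 * p : ℤ)) = -84 * p := by ring
  have hB : ((42 * p : ℤ) ^ 2 - 4 * (448 * p ^ 2)) = -28 * p ^ 2 := by ring
  have hb : (-28 * p ^ 2 : ℤ) ≠ 0 := mul_ne_zero (by norm_num) (pow_ne_zero 2 hp0)
  have hsub : twoIsogenySelmerGroup' (42 * p) (448 * p ^ 2) ⊆ ({1, -7, (p : ℤ) * (-14)} : Finset ℤ) := by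
    intro d hd
    rw [twoIsogenySelmerGroup'_eq, hA, hB, mem_twoIsogenySelmerGroup_iff hb] at hd
    obtain ⟨hsqf, ⟨d', hdd'⟩, hloc⟩ := hd
    have hd'eq : (-28 * p ^ 2 : ℤ) / d = d' := by
      rw [hdd', Int.mul_ediv_cancel_left _ hsqf.ne_zero]
    rw [hd'eq] at hloc
    obtain ⟨-, hpadic⟩ := hloc
    have hdisc : ∀ x y : ℤ, x * y = -28 * (p : ℤ) ^ 2 →
        (7 : ℤ) ∣ (-84 * (p : ℤ)) ^ 2 - 4 * x * y ∧ ¬ (7 : ℤ) ^ 2 ∣ (-84 * (p : ℤ)) ^ 2 - 4 * x * y := by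
      intro x y hxy
      have e1 : (-84 * (p : ℤ)) ^ 2 - 4 * x * y = 7168 * (p : ℤ) ^ 2 := by rw [mul_assoc, hxy]; ring
      rw [e1]
      refine ⟨⟨1024 * (p : ℤ) ^ 2, by ring⟩, fun h => ?_⟩
      have h7p : Prime (7 : ℤ) := Int.prime_iff_natAbs_prime.mpr (by norm_num)
      have h49 : (7 : ℤ) ^ 2 ∣ 7 * (1024 * (p : ℤ) ^ 2) := by rw [show (7168 : ℤ) * (p : ℤ) ^ 2 = 7 * (1024 * p ^ 2) by ring] at h; exact h
      have h7 : (7 : ℤ) ∣ 1024 * (p : ℤ) ^ 2 := by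
        rw [pow_two] at h49
        exact (mul_dvd_mul_iff_left (by norm_num : (7 : ℤ) ≠ 0)).mp h49
      rcases h7p.dvd_or_dvd h7 with h5 | h5
      · norm_num at h5
      · exact hp07Z ((ZMod.intCast_zmod_eq_zero_iff_dvd _ 7).mpr (h7p.dvd_of_dvd_pow h5))
    have h7p : Prime (7 : ℤ) := Int.prime_iff_natAbs_prime.mpr (by norm_num)
    have hnd7 : ∀ k : ℤ, ¬ (7 : ℤ) ∣ k → ∀ n : ℕ, ¬ (7 : ℤ) ∣ k * (p : ℤ) ^ n := by
      intro k hk n h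
      rcases h7p.dvd_or_dvd h with h5 | h5
      · exact hk h5
      · exact hp07Z ((ZMod.intCast_zmod_eq_zero_iff_dvd _ 7).mpr (h7p.dvd_of_dvd_pow h5))
    have kill : ∀ x y : ℤ, x * y = -28 * (p : ℤ) ^ 2 → ¬ (7 : ℤ) ∣ x →
        ((twoIsogenyQuartic (-84 * p) x y).map (Int.castRingHom ℚ_[7])).IsSoluble →
        ∃ r : ZMod 7, ((x : ℤ) : ZMod 7) = r * r := by
      intro x y hxy hx hsol
      obtain ⟨hB1, hB2⟩ := hdisc x y hxy
      exact (isSquare_zmod_of_isSoluble_padic (p := 7) (by norm_num) hx hB1 hB2 hsol).2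
    have kill' : ∀ x y : ℤ, x * y = -28 * (p : ℤ) ^ 2 → ¬ (7 : ℤ) ∣ y →
        ((twoIsogenyQuartic (-84 * p) x y).map (Int.castRingHom ℚ_[7])).IsSoluble →
        ∃ r : ZMod 7, ((y : ℤ) : ZMod 7) = r * r := by
      intro x y hxy hy hsol
      exact kill y x (by rw [mul_comm]; exact hxy) hy
        ((isSoluble_map_twoIsogenyQuartic_comm _ _ _ _).mp hsol)
    have h0 : d ∣ -28 * (p : ℤ) ^ 2 := ⟨d', hdd'⟩
    have h1 : d ∣ (14 * (p : ℤ)) ^ 2 := h0.trans ⟨-7, by ring⟩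
    have h14p : d ∣ 14 * (p : ℤ) := (hsqf.dvd_pow_iff_dvd (by norm_num)).mp h1
    simp only [Finset.mem_insert, Finset.mem_singleton]
    by_cases hpd : (p : ℤ) ∣ d
    · obtain ⟨e, rfl⟩ := hpd
      have he14 : e ∣ 14 := by
        have : (p : ℤ) * e ∣ (p : ℤ) * 14 := by rw [mul_comm (p : ℤ) 14]; exact h14p
        exact (mul_dvd_mul_iff_left hp0).mp this
      have hd'e : e * d' = -28 * p := mul_left_cancel₀ hp0 (by linear_combination (-1 : ℤ) * hdd')
      have hele : e ≤ 14 := Int.le_of_dvd (by norm_num) he14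
      have hege : -14 ≤ e := by
        have := Int.le_of_dvd (by norm_num) ((Int.neg_dvd).mpr he14); linarith
      -- at `2`: `e = 1, 2, -7`
      have hne1 : e ≠ 1 := by
        rintro rfl
        have hd'1 : d' = (p : ℤ) * (-28) := by linarith
        rw [hd'1] at hpadic
        exact k1 (hpadic 2)
      have hne2 : e ≠ 2 := by
        rintro rfl
        have hd'1 : d' = (p : ℤ) * (-14) := by linarith
        rw [hd'1] at hpadic
        exact k2 (hpadic 2)
      have hnem7 : e ≠ -7 := by
        rintro rfl
        have hd'1 : d' = (p : ℤ) * 4 := by linarith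
        rw [hd'1] at hpadic
        exact k7 (hpadic 2)
      -- at `7`: `e = -1, -2, 7, 14`
      have hnem1 : e ≠ -1 := by
        rintro rfl
        obtain ⟨r, hr⟩ := kill ((p : ℤ) * -1) d' (by linear_combination (p : ℤ) * hd'e)
          (by rw [mul_comm]; exact hnd7 (-1) (by decide) 1 ∘ (by intro h; simpa using h)) (hpadic 7)
        push_cast at hr
        exact (htab r).2.2.1 (by rw [← hr]; ring)
      have hnem2 : e ≠ -2 := by
        rintro rfl
        obtain ⟨r, hr⟩ := kill ((p : ℤ) * -2) d' (by linear_combination (p : ℤ) * hd'e)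
          (by rw [mul_comm]; exact hnd7 (-2) (by decide) 1 ∘ (by intro h; simpa using h)) (hpadic 7)
        push_cast at hr
        exact (htab r).2.2.2.1 (by rw [← hr]; ring)
      have hne7 : e ≠ 7 := by
        rintro rfl
        have hd'1 : d' = -4 * (p : ℤ) := by linarith
        obtain ⟨r, hr⟩ := kill' ((p : ℤ) * 7) d' (by linear_combination (p : ℤ) * hd'e)
          (by rw [hd'1]; exact hnd7 (-4) (by decide) 1 ∘ (by intro h; simpa using h)) (hpadic 7)
        rw [hd'1] at hr; push_cast at hr
        exact (htab r).2.2.2.2.1 (by rw [← hr])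
      have hne14 : e ≠ 14 := by
        rintro rfl
        have hd'1 : d' = -2 * (p : ℤ) := by linarith
        obtain ⟨r, hr⟩ := kill' ((p : ℤ) * 14) d' (by linear_combination (p : ℤ) * hd'e)
          (by rw [hd'1]; exact hnd7 (-2) (by decide) 1 ∘ (by intro h; simpa using h)) (hpadic 7)
        rw [hd'1] at hr; push_cast at hr
        exact (htab r).2.2.2.1 (by rw [← hr])
      obtain ⟨k, hk⟩ := he14
      interval_cases e <;> first | (exfalso; omega) | simp
    · have hcop : IsCoprime d (p : ℤ) := ((hpp.irreducible.coprime_iff_not_dvd).mpr hpd).symm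
      have hd14 : d ∣ 14 := hcop.dvd_of_dvd_mul_right h14p
      have hle : d ≤ 14 := Int.le_of_dvd (by norm_num) hd14
      have hge : -14 ≤ d := by
        have := Int.le_of_dvd (by norm_num) ((Int.neg_dvd).mpr hd14); linarith
      have hnm1 : d ≠ -1 := by
        rintro rfl
        obtain ⟨r, hr⟩ := kill (-1) d' hdd'.symm (by decide) (hpadic 7)
        push_cast at hr
        exact (htab r).1 hr.symm
      have hnm2 : d ≠ -2 := by
        rintro rfl
        obtain ⟨r, hr⟩ := kill (-2) d' hdd'.symm (by decide) (hpadic 7)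
        push_cast at hr
        exact (htab r).2.1 hr.symm
      have hn7 : d ≠ 7 := by
        rintro rfl
        have hd'1 : d' = -4 * (p : ℤ) ^ 2 := by linarith
        obtain ⟨r, hr⟩ := kill' 7 d' hdd'.symm (by rw [hd'1]; exact hnd7 (-4) (by decide) 2) (hpadic 7)
        rw [hd'1] at hr; push_cast at hr
        exact (htab r).2.2.2.2.2.1 hr.symm
      have hn14 : d ≠ 14 := by
        rintro rfl
        have hd'1 : d' = -2 * (p : ℤ) ^ 2 := by linarith
        obtain ⟨r, hr⟩ := kill' 14 d' hdd'.symm (by rw [hd'1]; exact hnd7 (-2) (by decide) 2) (hpadic 7)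
        rw [hd'1] at hr; push_cast at hr
        exact (htab r).2.2.2.2.2.2 hr.symm
      -- at `p`: `2` and `-14`
      have hn2 : d ≠ 2 := by
        rintro rfl
        have hd'1 : d' = (p : ℤ) ^ 2 * -14 := by linarith
        exact not_isSoluble_padic_of_nonresidue_of_sq_dvd (p := p) (c := -84) (e' := -14) (by ring)
          hd'1 h2 hm14 (hpadic p)
      have hnm14 : d ≠ -14 := by
        rintro rfl
        have hd'1 : d' = (p : ℤ) ^ 2 * 2 := by linarith
        exact not_isSoluble_padic_of_nonresidue_of_sq_dvd (p := p) (c := -84) (e' := 2) (by ring)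
          hd'1 hm14 h2 (hpadic p)
      obtain ⟨k, hk⟩ := hd14
      interval_cases d <;> first | (exfalso; omega) | simp
  obtain ⟨k, hk⟩ := exists_card_twoIsogenySelmerGroup'_eq_two_pow (hab_twoPosTwist hp.pos)
  have hle3 : (twoIsogenySelmerGroup' (42 * p) (448 * p ^ 2)).card ≤ 3 :=
    (Finset.card_le_card hsub).trans Finset.card_le_three
  rw [hk] at hle3 ⊢
  have hk2 : k < 2 := (Nat.pow_lt_pow_iff_right one_lt_two).mp (lt_of_le_of_lt hle3 (by norm_num))
  calc 2 ^ k ≤ 2 ^ 1 := Nat.pow_le_pow_right two_pos (by omega)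
    _ = 2 := by norm_num

/-! ## §3. Consequences: rank `0`, `Ш[2] = 0`, `corank₂ Sel_{2^∞} = 0` for every model of `49a1^{(2p)}` -/

/-- **`rank E_{2p}(ℚ) = 0` and `Ш(E_{2p})[2] = 0`** (UNCONDITIONAL) for the two-torsion model
`E_{2p} = [0, 21·(2p), 0, 112·(2p)², 0]`, `p ≡ 5 (mod 8)` prime with `(−7/p) = +1` (`#S·#S' ≤ 4`).
[cite: SilvermanAEC2009, Thm. X.4.2(a) and Prop. X.4.9] -/
theorem rank_eq_zero_and_sha_two_twoTorsionModel_twoPosTwist {p : ℕ} [Fact p.Prime] (hp8 : p % 8 = 5)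
    (hp7 : legendreSym p (-7) = 1)
    [hE : (⟨0, ((21 * (2 * (p : ℤ)) : ℤ) : ℚ), 0, ((112 * (2 * (p : ℤ)) ^ 2 : ℤ) : ℚ), 0⟩ : WeierstrassCurve ℚ).IsElliptic] :
    (⟨0, ((21 * (2 * (p : ℤ)) : ℤ) : ℚ), 0, ((112 * (2 * (p : ℤ)) ^ 2 : ℤ) : ℚ), 0⟩ : WeierstrassCurve ℚ).mordellWeilRank = 0 ∧
      ∀ c ∈ (⟨0, ((21 * (2 * (p : ℤ)) : ℤ) : ℚ), 0, ((112 * (2 * (p : ℤ)) ^ 2 : ℤ) : ℚ), 0⟩ : WeierstrassCurve ℚ).sha,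
        2 • c = 0 → c = 0 := by
  have hp : p.Prime := Fact.out
  have hab := hab_posTwist (M := (2 * (p : ℤ))) (mul_ne_zero two_ne_zero (by exact_mod_cast hp.ne_zero))
  haveI := isElliptic_halfModel hab
  have h42 : (21 * (2 * (p : ℤ))) = 42 * p := by ring
  have h448 : (112 * (2 * (p : ℤ)) ^ 2) = 448 * p ^ 2 := by ring
  refine rank_eq_zero_and_sha_two_of_card_le_two hab ?_ ?_
  · rw [h42, h448]; exact card_twoIsogenySelmerGroup_twoPosTwist_le hp8 hp7
  · rw [h42, h448]; exact card_twoIsogenySelmerGroup'_twoPosTwist_le hp8 hp7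

/-- **UNCONDITIONAL: `rank W(ℚ) = 0` and `Ш(W/ℚ)[2] = 0` for EVERY model `W` of `49a1^{(2p)}`**, `p ≡ 5 (mod 8)` prime
with `(−7/p) = +1`. [cite: SilvermanAEC2009, Thm. X.4.2(a), Prop. X.4.9, III.3.1(b)] -/
theorem rank_eq_zero_and_sha_two_twoPosTwist {p : ℕ} [Fact p.Prime] (hp8 : p % 8 = 5)
    (hp7 : legendreSym p (-7) = 1) (W : WeierstrassCurve ℚ) [W.IsElliptic] (C : VariableChange ℚ)
    (hC : C • W = cm7.quadraticTwist ((2 * (p : ℤ) : ℤ) : ℚ)) :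
    W.mordellWeilRank = 0 ∧ ∀ c ∈ W.sha, 2 • c = 0 → c = 0 := by
  have hp : p.Prime := Fact.out
  haveI := isElliptic_mk_of_ne_zero (F := ℚ)
    (hab_posTwist (M := (2 * (p : ℤ))) (mul_ne_zero two_ne_zero (by exact_mod_cast hp.ne_zero)))
  have hE := smul_eq_twoTorsionModel_of_smul_eq_quadraticTwist (2 * (p : ℤ)) W C hC
  exact rank_eq_zero_and_sha_two_of_smul_eq W _ _ hE
    (rank_eq_zero_and_sha_two_twoTorsionModel_twoPosTwist hp8 hp7)

/-- **`corank_{ℤ₂} Sel_{2^∞}(W/ℚ) = 0` for every model `W` of `49a1^{(2p)}`**, `p ≡ 5 (mod 8)` prime, `(−7/p) = +1`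
(Greenberg's identity `corank Sel = rank + corank Ш[2^∞]`, tree `selmerCorank_eq_mordellWeilRank_add_holds`) — the
hypothesis of Burungale–Tian's rank-zero `2`-converse, discharged unconditionally. [cite: Greenberg1999, §1]
[cite: SilvermanAEC2009, Thm. X.4.2(a) and Prop. X.4.9] -/
theorem selmerCorank_two_eq_zero_twoPosTwist {p : ℕ} [Fact p.Prime] (hp8 : p % 8 = 5)
    (hp7 : legendreSym p (-7) = 1) (W : WeierstrassCurve ℚ) [W.IsElliptic] (C : VariableChange ℚ)
    (hC : C • W = cm7.quadraticTwist ((2 * (p : ℤ) : ℤ) : ℚ)) : W.selmerCorank 2 = 0 := by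
  haveI : Fact (Nat.Prime 2) := ⟨Nat.prime_two⟩
  obtain ⟨hr, hsha⟩ := rank_eq_zero_and_sha_two_twoPosTwist hp8 hp7 W C hC
  rw [W.selmerCorank_eq_mordellWeilRank_add_holds 2, hr, W.shaCorank_eq_zero_of_forall 2 hsha]

end Summit.BirchSwinnertonDyer.BirchSwinnertonDyer.Theorems.GoldfeldGoodTwists

end
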